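/-
Copyright: statement-level skeleton of a published paper (lit-balaban cell, reader/typer r15). No proof claims beyond
what the kernel checks below.
-/
import Literature.MathematicalPhysics.QuantumFieldTheory.Balaban1983to89.HiggsCovariance
import Literature.MathematicalPhysics.QuantumFieldTheory.Balaban1983to89.B1LowerBound

/-!
# B3 — T. Bałaban, *(Higgs)₂,₃ quantum fields in a finite volume. III. Renormalization*, CMP **88** (1983) 411–445,
Sect. 1 p. 412: the multiscale representation (1.1)–(1.2) of the "old" vector field and the contour functional (1.3),
as CONCRETE definitions over the (Higgs)₂,₃ carriers `HiggsLattice` / `HiggsAveraging` / `HiggsCovariance`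

statement-level skeleton of published theorems with citation tags; proofs where landed; nothing here is a claim about
the Yang–Mills mass gap

Source: held text `paper:balaban1983-higgs-2-3-quantum-fields-finite-volume` (journal page = PDF page + 410); the
displays (1.1)–(1.3) were read on the ×2 render
`pub-balaban/b2b-balaban-ref1/pages/1983-cmp88-higgs23-III/1983-cmp88-higgs23-III-p002-x2.png` (p. 412) and a ×2 crop
of (1.3) (the subscript of the composite contour is `x_{j+1}, x`, not `x_{j+1}, x_j`); the cited formulas of paper I
[Balaban1982Higgs1] on the renders `1982-cmp85-higgs23-I-p006/p007/p015/p016-x2.png` (pp. 608, 609, 617, 618: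
(2.1)–(2.3), (2.11), (3.29), (3.33)–(3.34) and the sentence p. 608 *"The renormalization transformations for vector
fields will be obtained by taking N = d and an external vector field A = 0"*).  SKELETON rows B3.Eq1.1-1.2 and B3.Eq1.3
of `HOME/lit-balaban-r15/ROWS-B3.md` (fold owner r15); companion files `B3Sect1Statements` ((1.25)–(1.28), (1.32)),
`B3Prop1`, `B3Sect2Statements(…Part2)`, `B3Sect3Statements`.

## The setting (p. 411–412, verbatim)

*"Let us recall the formula for interaction terms of the action of the model after k renormalization transformations
… We will write this formula rescaled to the unit lattice with respect to "new" field variables after k steps. … The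
"old" vector field can be represented in the following way: A = A′ + A^{(k)} = A′^{(0),η} + … + A′^{(k−1),η} + A^{(k)},
η = L^{−k}, (1.1) where A′^{(j),η} = a_j(L^jη)^{−2}G^η_jQ^*_jA′_j, j = 1, …, k−1, A′^{(0),η} = A′_0, (1.2) and the fields
A′_j are defined on L^jη-lattice. The formula (1.2) extends to A^{(k)} with A′_k replaced by the "new" field A_k on the
unit lattice. Let us remind the reader also of the definition (I.3.34) of A(Γ^{(k)}_{y,x}), x ∈ B^k(y):
A(Γ^{(k)}_{y,x}) = Σ_{j=0}^{k−1} A′^{(j),η}(Γ^{(j+1)}_{x_{j+1},x}) + A^{(k)}(Γ^{(k)}_{y,x}), (1.3) where x_j is defined by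
the condition x ∈ B^j(x_j), x₀ = x, and the contours are defined in Chap. I.2. For an arbitrary vector field A defined
on η-lattice and an arbitrary contour Γ of this lattice we put A(Γ) = Σ_{b⊂Γ} ηA_b."*

## How it is typed (reuse, nothing re-declared)

* The lattices are the carrier tori `HiggsLattice.Site P j` (level `j`, spacing `P.mesh j = L^j · P.mesh 0`); the
  paper's picture is the carrier with finest spacing `P.mesh 0 = η = L^{−k}` (cf. `HiggsLattice.Params.unitAt` of
  `HiggsCovariance`), and every formula below is written with `P.mesh 0` for `η`, `P.mesh j` for `L^jη`.  The vector
  fields `A′_j` *"defined on L^jη-lattice"* are `HiggsLattice.VecField P j` (bond functions); following paper I p. 608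
  (*"N = d and … A = 0"*) they are viewed as `ℝ^d`-valued site functions `x ↦ (A_{⟨x,x+L^jηe_μ⟩})_μ`
  (`toSite`/`ofSite`), on which the typer's concrete operators act: `Q_j^*` = `HiggsCovariance.avgQkAdj` at the zero
  external field (PROVED here to be `(Q_j^*g)(x) = g(x_j)`, `qStar_apply`), `G_j^η` = `HiggsCovariance.propagatorK` on
  the whole torus at the zero external field (the inverse in the endomorphism ring, `Ring.inverse`, exactly as in that
  module — invertibility is not asserted), `a_j` = `B1.aSeq a L j` ((I.2.15)); the printed combination
  `a_j(L^jη)^{−2}G^η_jQ^*_j(·)` is r12's `B1LowerBound.bgField` ((I.3.29)) at these arguments (`fluctOp`).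
* (1.2): `fluctPiece` (by cases on `j`: `A′^{(0),η} = A′_0`, and the operator for `j ≥ 1`), `topPiece` (the extension
  to `A^{(k)}` with the new field `A_k`); (1.1): `oldField` = the printed sum.  The vector-field mass entering `G^η_j`
  (μ₀² of (I.1.11), rescaled: μ₀²(L^kε)² in the unit-lattice picture, (I.2.22)) is the parameter `msq`.
* (1.3): `etaSum`/`etaSumK` are the paper's `A(Γ) = Σ_{b⊂Γ} ηA_b` for the staircase contour `Γ_{y,x}` and the
  composite contour `Γ^{(k)}_{x_k,x}` of (I.2.1)–(I.2.2) (`HiggsAveraging.contourSum`/`multiContourSum`, which are the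
  sums WITHOUT the factor η — paper I's convention (I.2.3)); `contour13` is the display (1.3) for an arbitrary family
  of η-lattice fields `j ↦ A′^{(j),η}` and top field `A^{(k)}`, and `contour13Model` its instance at the fields (1.2).
  PROVED bookkeeping: the recursion in `k` (`contour13_succ`), linearity in the top field (`contour13_top_add`, the
  form used on p. 412 for *"A^{(k)} replaced by Ã + B̃"*), and the relation to the plain linear functional of the
  field (1.1) (`contour13_eq_linear_sub_upper`): (1.3) integrates the `j`-th fluctuation field only along the lower
  part `Γ^{(j+1)}_{x_{j+1},x}` of `Γ^{(k)}_{x_k,x}`, i.e. it equals `A(Γ^{(k)}_{x_k,x})` for `A` = (1.1) MINUS the sums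
  of the `A′^{(j),η}` over the upper segments `Γ_{x_{i+1},x_i}`, `j+1 ≤ i < k` (`upperSum`, `multiContourSum_split`).
  Nothing of the paper beyond these displayed definitions is asserted.
-/

open scoped BigOperators
open NormedSpace

namespace Literature.MathematicalPhysics.QuantumFieldTheory.Balaban1983to89.B3MultiscaleFields

open Literature.MathematicalPhysics.QuantumFieldTheory.Balaban1983to89.HiggsLattice
open Literature.MathematicalPhysics.QuantumFieldTheory.Balaban1983to89.HiggsAveraging
open Literature.MathematicalPhysics.QuantumFieldTheory.Balaban1983to89.HiggsCovariance

variable {P : Params}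

/-! ## 1. Vector fields as `ℝ^d`-valued site functions (paper I p. 608: *"N = d and … A = 0"*) -/

/-- A bond function `A` on `T^{(j)}` viewed as the `ℝ^d`-valued site function `x ↦ (A_{⟨x, x+L^jηe_μ⟩})_{μ=1..d}`
(paper I p. 608 [PDF 6]: *"The renormalization transformations for vector fields will be obtained by taking N = d and
an external vector field A = 0, so we will not consider them separately"*; `A_μ(x) = A_{⟨x,x+εe_μ⟩}`, paper I p. 604).
[cite: Balaban1982Higgs1, p.608] -/
noncomputable def toSite {j : ℕ} (A : VecField P j) : ScalarField P j P.d :=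
  fun x => WithLp.toLp 2 fun μ => A ⟨x, μ⟩

/-- The inverse identification: an `ℝ^d`-valued site function as a bond function, `A_{⟨x,x+L^jηe_μ⟩} = f(x)_μ`.
[cite: Balaban1982Higgs1, p.608] -/
noncomputable def ofSite {j : ℕ} (f : ScalarField P j P.d) : VecField P j :=
  fun b => f b.src b.dir

/-- `ofSite ∘ toSite = id` (definitional bookkeeping). [cite: Balaban1982Higgs1, p.608] -/
@[simp] theorem ofSite_toSite {j : ℕ} (A : VecField P j) : ofSite (toSite A) = A := by
  funext b
  cases b
  rfl

/-- `toSite ∘ ofSite = id` (definitional bookkeeping). [cite: Balaban1982Higgs1, p.608] -/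
@[simp] theorem toSite_ofSite {j : ℕ} (f : ScalarField P j P.d) : toSite (ofSite f) = f := by
  funext x
  rfl

/-- `toSite` is additive. [cite: Balaban1982Higgs1, p.608] -/
theorem toSite_add {j : ℕ} (A B : VecField P j) : toSite (A + B) = toSite A + toSite B := by
  funext x
  ext μ
  rfl

/-- `ofSite` is additive. [cite: Balaban1982Higgs1, p.608] -/
theorem ofSite_add {j : ℕ} (f g : ScalarField P j P.d) : ofSite (f + g) = ofSite f + ofSite g := by
  funext b
  rfl

/-- The zero external field has the trivial coupling: the `ChargeData` with `e = 0`, `q = 0`, for which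
`U(A) = exp(qηeA) = 1` identically — the *"external vector field A = 0"* case of paper I p. 608 in which the vector
field's own averaging operators are the plain block averages. [cite: Balaban1982Higgs1, p.608] -/
noncomputable def zeroCharge (d : ℕ) : ChargeData d :=
  ⟨0, 0, (star_zero (EuclideanSpace ℝ (Fin d) →L[ℝ] EuclideanSpace ℝ (Fin d))).trans neg_zero.symm, by simp⟩

/-- For the trivial coupling every transport is the identity: `U = exp 0 = 1`. [cite: Balaban1982Higgs1, (1.7) p.605] -/
theorem zeroCharge_U (d : ℕ) (η t : ℝ) : (zeroCharge d).U η t = 1 := by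
  have h : (η * (zeroCharge d).e * t) • (zeroCharge d).q = 0 := by
    have he : (zeroCharge d).e = 0 := rfl
    rw [he, mul_zero, zero_mul]
    exact zero_smul ℝ (zeroCharge d).q
  unfold ChargeData.U
  rw [h, exp_zero]

/-- **`Q_j^*` concretely.**  At the zero external field the typer's adjoint averaging operator
`HiggsCovariance.avgQkAdj` ((I.2.20), adjoint of (I.2.11) for the scalar products (I.1.5) of the two lattices) is the
piecewise-constant injection `(Q_j^* g)(x) = g(x_j)`, `x ∈ B^j(x_j)` — the operator `Q_j^*` of (1.2). PROVED.
[cite: Balaban1983Higgs3, (1.2) p.412] -/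
theorem qStar_apply (j : ℕ) (g : ScalarField P j P.d) (x : Site P 0) :
    avgQkAdj (zeroCharge P.d) (0 : VecField P 0) j g x = g (blockIter j x) := by
  simp [avgQkAdj, zeroCharge_U]

/-! ## 2. (1.2): the fluctuation pieces `A′^{(j),η} = a_j(L^jη)^{−2}G^η_jQ^*_jA′_j` and (1.1) -/

section Representation

/-- The operator `a_j(L^jη)^{−2} G^η_j Q^*_j` of **(1.2)** p. 412 [PDF 2] from `ℝ^d`-valued site functions on the
`L^jη`-lattice to those on the `η`-lattice: `a_j` = `B1.aSeq a L j` ((I.2.15)), `L^jη` = `P.mesh j`, `Q_j^*` =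
`HiggsCovariance.avgQkAdj` and `G^η_j` = `HiggsCovariance.propagatorK` (the vector-field propagator
`(−Δ^η + msq + a_j(L^jη)^{−2}P_j)^{−1}` on the whole torus, (I.2.20)/(I.2.22) with `N = d`, external field `0`; `msq` =
the vector-field mass, μ₀²(L^kε)² in the unit-lattice picture), assembled by r12's `B1LowerBound.bgField` (the shape of
(I.3.29): *"A′^{(j),ε} are given by the formula (3.29) with A′_j instead of A"*, paper I p. 617).
[cite: Balaban1983Higgs3, (1.2) p.412] -/
noncomputable def fluctOp (msq a : ℝ) (j : ℕ) (g : ScalarField P j P.d) : ScalarField P 0 P.d :=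
  B1LowerBound.bgField (B1.aSeq a P.L j) (P.mesh j)
    (propagatorK (zeroCharge P.d) Finset.univ (0 : VecField P 0) msq a j)
    (avgQkAdj (zeroCharge P.d) (0 : VecField P 0) j) g

/-- Unfolding of `fluctOp`: `a_j(L^jη)^{−2} · G^η_j (Q^*_j g)`. [cite: Balaban1983Higgs3, (1.2) p.412] -/
theorem fluctOp_eq (msq a : ℝ) (j : ℕ) (g : ScalarField P j P.d) :
    fluctOp msq a j g = (B1.aSeq a P.L j * (P.mesh j ^ 2)⁻¹) •
      propagatorK (zeroCharge P.d) Finset.univ (0 : VecField P 0) msq a j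
        (avgQkAdj (zeroCharge P.d) (0 : VecField P 0) j g) := rfl

/-- `fluctOp` is additive (it is a composite of linear maps). [cite: Balaban1983Higgs3, (1.2) p.412] -/
theorem fluctOp_add (msq a : ℝ) (j : ℕ) (g g' : ScalarField P j P.d) :
    fluctOp msq a j (g + g') = fluctOp msq a j g + fluctOp msq a j g' :=
  B1LowerBound.bgField_add _ _ _ _ g g'

/-- **(1.2)** p. 412 [PDF 2], verbatim: *"A′^{(j),η} = a_j(L^jη)^{−2}G^η_jQ^*_jA′_j, j = 1, …, k−1, A′^{(0),η} = A′_0, (1.2)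
and the fields A′_j are defined on L^jη-lattice."* — the `j`-th fluctuation field carried to the `η`-lattice (by cases
on `j`: the field itself for `j = 0`, the operator `fluctOp` for `j ≥ 1`). [cite: Balaban1983Higgs3, (1.2) p.412] -/
noncomputable def fluctPiece (msq a : ℝ) : (j : ℕ) → VecField P j → VecField P 0
  | 0, A => A
  | j + 1, A => ofSite (fluctOp msq a (j + 1) (toSite A))

/-- (1.2) at `j = 0`: `A′^{(0),η} = A′_0`. [cite: Balaban1983Higgs3, (1.2) p.412] -/
@[simp] theorem fluctPiece_zero (msq a : ℝ) (A : VecField P 0) : fluctPiece msq a 0 A = A := rfl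

/-- (1.2) at `j ≥ 1`: `A′^{(j),η} = a_j(L^jη)^{−2}G^η_jQ^*_jA′_j`. [cite: Balaban1983Higgs3, (1.2) p.412] -/
theorem fluctPiece_succ (msq a : ℝ) (j : ℕ) (A : VecField P (j + 1)) :
    fluctPiece msq a (j + 1) A = ofSite (fluctOp msq a (j + 1) (toSite A)) := rfl

/-- **(1.2) extended** p. 412: *"The formula (1.2) extends to A^{(k)} with A′_k replaced by the "new" field A_k on the
unit lattice"* — `A^{(k)} = a_k(L^kη)^{−2}G^η_kQ^*_kA_k` (the paper's range is `k ≥ 1`). [cite: Balaban1983Higgs3, (1.2) p.412] -/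
noncomputable def topPiece (msq a : ℝ) (k : ℕ) (Ak : VecField P k) : VecField P 0 :=
  ofSite (fluctOp msq a k (toSite Ak))

/-- The top piece is additive in the new field (`A_k ↦ Ã + B̃`, p. 412). [cite: Balaban1983Higgs3, (1.2) p.412] -/
theorem topPiece_add (msq a : ℝ) (k : ℕ) (A B : VecField P k) :
    topPiece msq a k (A + B) = topPiece msq a k A + topPiece msq a k B := by
  simp [topPiece, toSite_add, fluctOp_add, ofSite_add]

/-- **(1.1)** p. 412 [PDF 2], verbatim: *"The "old" vector field can be represented in the following way:
A = A′ + A^{(k)} = A′^{(0),η} + … + A′^{(k−1),η} + A^{(k)}, η = L^{−k}, (1.1)"* — the field on the `η`-lattice assembled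
from the fluctuation fields `A′_j` on the `L^jη`-lattices (`j < k`) and the new field `A_k` by (1.2).
[cite: Balaban1983Higgs3, (1.1) p.412] -/
noncomputable def oldField (msq a : ℝ) (k : ℕ) (A' : (j : ℕ) → VecField P j) (Ak : VecField P k) : VecField P 0 :=
  (∑ j ∈ Finset.range k, fluctPiece msq a j (A' j)) + topPiece msq a k Ak

/-- (1.1) split as printed: `A = A′ + A^{(k)}` with `A′ = Σ_{j<k} A′^{(j),η}`. [cite: Balaban1983Higgs3, (1.1) p.412] -/
theorem oldField_eq (msq a : ℝ) (k : ℕ) (A' : (j : ℕ) → VecField P j) (Ak : VecField P k) :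
    oldField msq a k A' Ak = (∑ j ∈ Finset.range k, fluctPiece msq a j (A' j)) + topPiece msq a k Ak := rfl

end Representation

/-! ## 3. (1.3): the contour functional `A(Γ^{(k)}_{y,x})` -/

section Contour

/-- `A(Γ_{y,x}) = Σ_{b ⊂ Γ_{y,x}} η A_b` for the staircase contour (I.2.1) on the `η`-lattice — p. 412: *"For an
arbitrary vector field A defined on η-lattice and an arbitrary contour Γ of this lattice we put A(Γ) = Σ_{b⊂Γ} ηA_b"*
(`HiggsAveraging.contourSum` is the sum without the factor `η`, paper I's (I.2.3)). [cite: Balaban1983Higgs3, (1.3) p.412] -/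
noncomputable def etaSum (A : VecField P 0) (y x : Site P 0) : ℝ :=
  P.mesh 0 * contourSum A y x

/-- `A(Γ^{(k)}_{x_k,x}) = Σ_{b ⊂ Γ^{(k)}_{x_k,x}} η A_b` for the composite contour (I.2.2) of order `k` ending at `x`
(`x_k` = `blockIter k x`; `HiggsAveraging.multiContourSum` times `η`). [cite: Balaban1983Higgs3, (1.3) p.412] -/
noncomputable def etaSumK (A : VecField P 0) (k : ℕ) (x : Site P 0) : ℝ :=
  P.mesh 0 * multiContourSum A k x

/-- `etaSumK` unfolds to `η · A(Γ^{(k)})` in paper I's convention. [cite: Balaban1983Higgs3, (1.3) p.412] -/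
theorem etaSumK_eq (A : VecField P 0) (k : ℕ) (x : Site P 0) :
    etaSumK A k x = P.mesh 0 * multiContourSum A k x := rfl

/-- The empty composite contour: `A(Γ^{(0)}_{x,x}) = 0`. [cite: Balaban1983Higgs3, (1.3) p.412] -/
@[simp] theorem etaSumK_zero (A : VecField P 0) (x : Site P 0) : etaSumK A 0 x = 0 := by
  simp [etaSumK, multiContourSum_zero]

/-- One more level: `A(Γ^{(k+1)}_{x_{k+1},x}) = A(Γ^{(k)}_{x_k,x}) + A(Γ_{x_{k+1},x_k})` ((I.2.2)). [cite: Balaban1983Higgs3, (1.3) p.412] -/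
theorem etaSumK_succ (A : VecField P 0) (k : ℕ) (x : Site P 0) :
    etaSumK A (k + 1) x = etaSumK A k x + etaSum A (toFinest (blockIter (k + 1) x)) (toFinest (blockIter k x)) := by
  simp [etaSumK, etaSum, multiContourSum_succ, mul_add]

/-- `A ↦ A(Γ^{(k)})` is additive. [cite: Balaban1983Higgs3, (1.3) p.412] -/
theorem etaSumK_add (A B : VecField P 0) (k : ℕ) (x : Site P 0) :
    etaSumK (A + B) k x = etaSumK A k x + etaSumK B k x := by
  simp [etaSumK, multiContourSum_add, mul_add]

/-- `A ↦ A(Γ^{(k)})` vanishes at `A = 0`. [cite: Balaban1983Higgs3, (1.3) p.412] -/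
@[simp] theorem etaSumK_zero_field (k : ℕ) (x : Site P 0) : etaSumK (0 : VecField P 0) k x = 0 := by
  simp [etaSumK, multiContourSum, contourSum, segSum]

/-- `A ↦ A(Γ^{(k)})` is finitely additive. [cite: Balaban1983Higgs3, (1.3) p.412] -/
theorem etaSumK_sum {ι : Type*} (s : Finset ι) (F : ι → VecField P 0) (k : ℕ) (x : Site P 0) :
    etaSumK (∑ i ∈ s, F i) k x = ∑ i ∈ s, etaSumK (F i) k x := by
  classical
  induction s using Finset.induction_on with
  | empty => simp
  | insert i s hi ih => rw [Finset.sum_insert hi, Finset.sum_insert hi, etaSumK_add, ih]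

/-- **(1.3)** p. 412 [PDF 2], verbatim: *"A(Γ^{(k)}_{y,x}) = Σ_{j=0}^{k−1} A′^{(j),η}(Γ^{(j+1)}_{x_{j+1},x}) +
A^{(k)}(Γ^{(k)}_{y,x}), (1.3) where x_j is defined by the condition x ∈ B^j(x_j), x₀ = x, and the contours are defined
in Chap. I.2"* (= the convention (I.3.34)) — for a family `F j = A′^{(j),η}` of fields on the `η`-lattice and the top
field `Ftop = A^{(k)}`; `y = x_k` is determined by `x`.  The `j`-th field is summed along the composite contour of
order `j+1` from `x_{j+1}` down to `x` only. [cite: Balaban1983Higgs3, (1.3) p.412] -/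
noncomputable def contour13 (k : ℕ) (F : ℕ → VecField P 0) (Ftop : VecField P 0) (x : Site P 0) : ℝ :=
  (∑ j ∈ Finset.range k, etaSumK (F j) (j + 1) x) + etaSumK Ftop k x

/-- (1.3) with no step done (`k = 0`): the contour is empty and `A(Γ^{(0)}_{x,x}) = 0`. [cite: Balaban1983Higgs3, (1.3) p.412] -/
@[simp] theorem contour13_zero (F : ℕ → VecField P 0) (Ftop : VecField P 0) (x : Site P 0) :
    contour13 0 F Ftop x = 0 := by
  simp [contour13]

/-- (1.3) after one step: `A(Γ^{(1)}_{x_1,x}) = A′^{(0),η}(Γ^{(1)}_{x_1,x}) + A^{(1)}(Γ^{(1)}_{x_1,x})`.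
[cite: Balaban1983Higgs3, (1.3) p.412] -/
theorem contour13_one (F : ℕ → VecField P 0) (Ftop : VecField P 0) (x : Site P 0) :
    contour13 1 F Ftop x = etaSumK (F 0) 1 x + etaSumK Ftop 1 x := by
  simp [contour13]

/-- The recursion of (1.3) in the number of steps: passing from `k` to `k + 1` fields adds the term of the new
fluctuation field `F k` along `Γ^{(k+1)}_{x_{k+1},x}` (the top field being summed along the longer contour).
[cite: Balaban1983Higgs3, (1.3) p.412] -/
theorem contour13_succ (k : ℕ) (F : ℕ → VecField P 0) (Ftop : VecField P 0) (x : Site P 0) :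
    contour13 (k + 1) F Ftop x
      = (∑ j ∈ Finset.range k, etaSumK (F j) (j + 1) x) + etaSumK (F k) (k + 1) x + etaSumK Ftop (k + 1) x := by
  simp [contour13, Finset.sum_range_succ]

/-- (1.3) is additive in the top field — the form in which it is used on p. 412 (*"the expressions in (1.5) with
A^{(k)} replaced by Ã + B̃ and the expansion taken with respect to Ã"*): `…(Γ) + Ã(Γ^{(k)}_{y,x}) + B̃(Γ^{(k)}_{y,x})`.
PROVED. [cite: Balaban1983Higgs3, (1.3) p.412] -/
theorem contour13_top_add (k : ℕ) (F : ℕ → VecField P 0) (A B : VecField P 0) (x : Site P 0) :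
    contour13 k F (A + B) x = contour13 k F A x + etaSumK B k x := by
  simp [contour13, etaSumK_add, add_assoc]

/-- The UPPER part of the composite contour above level `j+1`:
`Σ_{i=j+1}^{k−1} A(Γ_{x_{i+1},x_i})` (paper I's convention, no factor η) — the segments of `Γ^{(k)}_{x_k,x}` that (1.3)
does NOT use for the `j`-th fluctuation field. [cite: Balaban1983Higgs3, (1.3) p.412] -/
noncomputable def upperSum (A : VecField P 0) (j k : ℕ) (x : Site P 0) : ℝ :=
  ∑ i ∈ Finset.Ico (j + 1) k, contourSum A (toFinest (blockIter (i + 1) x)) (toFinest (blockIter i x))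

/-- Splitting the composite contour (I.2.2) at level `j+1 ≤ k`:
`A(Γ^{(k)}_{x_k,x}) = A(Γ^{(j+1)}_{x_{j+1},x}) + Σ_{i=j+1}^{k−1} A(Γ_{x_{i+1},x_i})`. PROVED. [cite: Balaban1983Higgs3, (1.3) p.412] -/
theorem multiContourSum_split (A : VecField P 0) {j k : ℕ} (h : j + 1 ≤ k) (x : Site P 0) :
    multiContourSum A k x = multiContourSum A (j + 1) x + upperSum A j k x := by
  unfold multiContourSum upperSum
  rw [Finset.range_eq_Ico, Finset.range_eq_Ico, ← Finset.sum_Ico_consecutive _ (Nat.zero_le (j + 1)) h]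

/-- **(1.3) versus linearity.**  For the field (1.1) `A = Σ_{j<k} A′^{(j),η} + A^{(k)}` evaluated LINEARLY on the whole
contour one would get `Σ_j A′^{(j),η}(Γ^{(k)}_{x_k,x}) + A^{(k)}(Γ^{(k)}_{x_k,x})`; the convention (1.3) = (I.3.34) keeps,
for the `j`-th fluctuation field, only the lower part `Γ^{(j+1)}_{x_{j+1},x}`:
`(1.3) = A(Γ^{(k)}_{x_k,x}) − Σ_{j<k} η Σ_{i=j+1}^{k−1} A′^{(j),η}(Γ_{x_{i+1},x_i})`. PROVED (bookkeeping making the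
convention explicit; nothing of the paper is asserted). [cite: Balaban1983Higgs3, (1.3) p.412] -/
theorem contour13_eq_linear_sub_upper (k : ℕ) (F : ℕ → VecField P 0) (Ftop : VecField P 0) (x : Site P 0) :
    contour13 k F Ftop x
      = etaSumK ((∑ j ∈ Finset.range k, F j) + Ftop) k x
          - ∑ j ∈ Finset.range k, P.mesh 0 * upperSum (F j) j k x := by
  rw [etaSumK_add, etaSumK_sum, contour13]
  have hsplit : ∀ j ∈ Finset.range k,
      etaSumK (F j) k x = etaSumK (F j) (j + 1) x + P.mesh 0 * upperSum (F j) j k x := by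
    intro j hj
    rw [etaSumK, etaSumK, multiContourSum_split (F j) (Finset.mem_range.mp hj) x, mul_add]
  rw [Finset.sum_congr rfl hsplit, Finset.sum_add_distrib]
  ring

/-- **(1.3) for the model fields (1.1)–(1.2)**: `A(Γ^{(k)}_{y,x})` with `A′^{(j),η} = fluctPiece … j (A′_j)` and
`A^{(k)} = topPiece … k A_k`. [cite: Balaban1983Higgs3, (1.3) p.412] -/
noncomputable def contour13Model (msq a : ℝ) (k : ℕ) (A' : (j : ℕ) → VecField P j) (Ak : VecField P k)
    (x : Site P 0) : ℝ :=
  contour13 k (fun j => fluctPiece msq a j (A' j)) (topPiece msq a k Ak) x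

/-- The model instance of (1.3) is additive in the new field `A_k` (p. 412, expansion in `Ã` after `A_k ↦ Ã + B̃`).
PROVED. [cite: Balaban1983Higgs3, (1.3) p.412] -/
theorem contour13Model_top_add (msq a : ℝ) (k : ℕ) (A' : (j : ℕ) → VecField P j) (A B : VecField P k)
    (x : Site P 0) :
    contour13Model msq a k A' (A + B) x
      = contour13Model msq a k A' A x + etaSumK (topPiece msq a k B) k x := by
  simp [contour13Model, topPiece_add, contour13_top_add]

/-- The transport `U(A(Γ^{(k)}_{y,x}))` of the averaging operators `Q_k(·)` in the renormalization transformation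
`T^η_{a_k,L^k,e′g_kA′+A^{(k)}}` of (1.4) p. 412 (and, through `A′(Γ^{(k)}_{y,x})`, in the vertices (1.14) p. 414), with
the multiscale convention (1.3): `exp(q e A(Γ^{(k)}_{y,x}))` for a coupling `C` (`HiggsLattice.ChargeData.U` at spacing
`1`, the factor `η` being already inside `A(Γ)` per the B3 convention `A(Γ) = Σ ηA_b`). [cite: Balaban1983Higgs3, (1.3)–(1.4) p.412] -/
noncomputable def holK13 {N : ℕ} (C : ChargeData N) (k : ℕ) (F : ℕ → VecField P 0) (Ftop : VecField P 0)
    (x : Site P 0) : EuclideanSpace ℝ (Fin N) →L[ℝ] EuclideanSpace ℝ (Fin N) :=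
  C.U 1 (contour13 k F Ftop x)

/-- With the factor `η` moved into `U`: for a SINGLE field summed over the whole contour (no fluctuation fields,
`k` arbitrary) the B3 transport is paper I's `U(A(Γ^{(k)}))` at spacing `η`, i.e. the transport inside
`HiggsAveraging.holQk`: `U_1(η·ΣA_b) = U_η(ΣA_b)`. PROVED. [cite: Balaban1983Higgs3, (1.3) p.412] -/
theorem holK13_top_only {N : ℕ} (C : ChargeData N) (k : ℕ) (Ftop : VecField P 0) (x : Site P 0) :
    holK13 C k (fun _ => 0) Ftop x = C.U (P.mesh 0) (multiContourSum Ftop k x) := by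
  have h : contour13 k (fun _ => (0 : VecField P 0)) Ftop x = P.mesh 0 * multiContourSum Ftop k x := by
    simp only [contour13, etaSumK_zero_field, Finset.sum_const_zero, zero_add]
    rfl
  have h' : (1 : ℝ) * C.e * (P.mesh 0 * multiContourSum Ftop k x) = P.mesh 0 * C.e * multiContourSum Ftop k x := by
    ring
  rw [holK13, h, ChargeData.U, ChargeData.U, h']

end Contour

end Literature.MathematicalPhysics.QuantumFieldTheory.Balaban1983to89.B3MultiscaleFields
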